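/-
STUB-IDEATION companion — `stub_switch`, ideator k = 1, GENERATION 9 (HOME FAMILY 1 — RECOGNISE & IMPORT).
Crux `stmt-ABC-11340` = `Summit.ABC.ABC.Theses.DefiniteXi.FreyModularity`; stub `Sketch.stub_switch`
(`≡ BCDT.CDT_three_five_switch`).  NOT a route file, NOT a Theorems file.  Road = k2 gens 2–8
(`StubSwitchK2G8`: `CuspForcedSource ⇐ SquareSource ∧ IntegralModel ∧ CuspMemberSource ∧ SurjThreeOfCuspData`).

RESULT OF THIS FILE (farm rc 0; axioms of `helper_frob_addOneSq_three'` = propext, Classical.choice, Quot.sound):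
the whole TATE BLOCK of Piece C — k2-g8's open helpers `T1 helper_twistedTate_addOneSq_local` and
`T2 helper_frob_addOneSq_three` — is DISCHARGED here, SORRY-FREE, by recognising it as a composition of tree
theorems (IMPORTS 1–8 below): `helper_frob_addOneSq_three'` has EXACTLY T2's signature.  The re-cut is the
EIGENLINE form of the twisted Tate curve (E1/E2: one common sign `ε` for all levels), the sign read at the odd
level `5` (E3), decomposition-group conjugation (E4), `χ̄_N(φ) = 1 ⇒ φ` fixes `μ_N` (E5), and `2 × 2`
Cayley–Hamilton with `det ρ̄₃(φ) = χ̄₃(φ) = 1` (E7).  The only `sorry`s left are E8 (an ALTERNATIVE to k2-g8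
FIN2+Rneg, optional) and A1 (Plan-A aside, optional); neither is on the road.
-/
import Literature.NumberTheory.EllipticCurves.TorsionFrobenius
import Literature.NumberTheory.EllipticCurves.TateCurve.NumberFieldUniformizationTwistedTateJ
import Literature.NumberTheory.EllipticCurves.TateParametrisationTorsion
import Literature.NumberTheory.EllipticCurves.NeronOggShafarevichLocal
import Literature.NumberTheory.EllipticCurves.MultiplicativeUnipotentTorsionProofs
import Literature.NumberTheory.EllipticCurves.MultiplicativeTransvectionPrimeToVProofs
import Literature.NumberTheory.EllipticCurves.SerreOpenImageDeterminantProofs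
import Literature.NumberTheory.EllipticCurves.MatarNekovar2019.IrreducibleOverQuadraticFieldProofs
import Literature.NumberTheory.EllipticCurves.PeriodIndexLocalTriviality
import Literature.NumberTheory.EllipticCurves.Kato2004.SemilocalDecompositionProofs
import Literature.NumberTheory.GaloisRepresentations.DecompositionGroupOfCompletion
import Literature.NumberTheory.GaloisRepresentations.IntegralGaloisActionProofs
import Literature.NumberTheory.GaloisRepresentations.ModNCyclotomicCharacter
import Mathlib.NumberTheory.Padics.HeightOneSpectrum
import HarnessLib

set_option linter.dupNamespace false
set_option linter.unusedVariables false

noncomputable section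

open scoped NumberField Classical Pointwise
open Literature.NumberTheory.EllipticCurves Literature.NumberTheory.GaloisRepresentations
open WeierstrassCurve Field NumberField IsDedekindDomain Matrix

namespace Summit.ABC.ABC.Cruxes.FreyModularity.StubSwitchK1G9

/-! ## §0  Shape sanity — the IMPORTED tree theorems, instantiated by name -/

/-- IMPORT 1 (PROVED in tree): the twisted Tate uniformisation at a multiplicative place
(Silverman ATAEC Thm V.5.3; `TateCurve.exists_twistedTateUniformisation_tateJ`). -/
example {K : Type} [Field K] [NumberField K] (W : WeierstrassCurve K) [W.IsElliptic]
    (v : HeightOneSpectrum (𝓞 K)) (hmult : W.HasMultiplicativeReductionAt v) :=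
  TateCurve.exists_twistedTateUniformisation_tateJ W v hmult

/-- IMPORT 2 (PROVED): the decomposition group of the completion prime is the image of `Γ_{K_v}`. -/
example (K : Type) [Field K] [NumberField K] (v : HeightOneSpectrum (𝓞 K)) :
    (adicCompletionPrime K v).decompositionSubgroup (absoluteGaloisGroup K) =
      (absGaloisRestrict K (v.adicCompletion K)).toMonoidHom.range :=
  decompositionSubgroup_adicCompletionPrime_eq_range K v

/-- IMPORT 3 (PROVED, Mathlib): a Frobenius lies in the decomposition group — this IS k2-g4's
`helper_frob_mem_decompositionSubgroup` (`decompositionSubgroup` is an `abbrev` for the stabiliser). -/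
example {v : HeightOneSpectrum (𝓞 ℚ)} {𝔓 : Ideal (absIntegers (𝓞 ℚ) ℚ)} (h𝔓 : 𝔓 ∈ v.primesAbove)
    {φ : absoluteGaloisGroup ℚ} (hφ : IsArithFrobAt (𝓞 ℚ) φ 𝔓) :
    φ ∈ 𝔓.decompositionSubgroup (absoluteGaloisGroup ℚ) := by
  haveI := h𝔓.1
  exact hφ.mem_stabilizer

/-- IMPORT 4 (PROVED): `Γ_K` is transitive on the primes above `v`. -/
example (K : Type) [Field K] [NumberField K] (v : HeightOneSpectrum (𝓞 K)) :
    HeightOneSpectrum.exists_smul_eq_of_mem_primesAbove (K := K) (v := v) :=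
  HeightOneSpectrum.exists_smul_eq_of_mem_primesAbove_holds

/-- IMPORT 5 (PROVED): torsion of `E(K̄_v)` comes from `E(K̄)`, equivariantly (`pointsMap_smul`). -/
example {K : Type} [Field K] [NumberField K] (W : WeierstrassCurve K) [W.IsElliptic]
    (v : HeightOneSpectrum (𝓞 K)) {m : ℕ} (hm : m ≠ 0) {Q : localPoints W (v.adicCompletion K)}
    (hQ : m • Q = 0) :
    ∃ P : geomPoints W, m • P = 0 ∧
      pointsMapOfEmb W (closureEmb (K := K) (v.adicCompletion K)) P = Q :=
  exists_pointsMapOfEmb_eq_of_nsmul_eq_zero W (closureEmb (K := K) (v.adicCompletion K)) hm hQ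

/-- IMPORT 6 (PROVED): the chosen embedding `K̄ → K̄_v` intertwines `resGal`. -/
example {K : Type} [Field K] (K' : Type) [Field K'] [Algebra K K'] (σ : absoluteGaloisGroup K')
    (x : AlgebraicClosure K) :
    closureEmb (K := K) K' (resGal (K := K) K' σ • x) = σ • closureEmb (K := K) K' x :=
  closureEmb_resGal_smul K' σ x

/-- IMPORT 7 (PROVED): `det ρ̄_{E,p} = χ̄_p` on a basis of `E[p]` (Matar–Nekovář file). -/
example (W : WeierstrassCurve ℚ) [W.IsElliptic] (p : ℕ) [Fact p.Prime] [NeZero (p : ℚ)]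
    (σ : absoluteGaloisGroup ℚ) {P₀ P₁ : geomTorsion W (p : ℤ)} {a b c d : ℤ} (hP₀ : P₀ ≠ 0)
    (hP₁ : P₁ ∉ AddSubgroup.zmultiples P₀) (h₀ : σ • P₀ = a • P₀ + c • P₁)
    (h₁ : σ • P₁ = b • P₀ + d • P₁) :
    ((modPCyclotomicCharacterZMod ℚ p σ : (ZMod p)ˣ) : ZMod p) = ((a * d - b * c : ℤ) : ZMod p) :=
  MatarNekovar2019.modPCyclotomicCharacter_eq_det_of_basis W p hP₀ hP₁ h₀ h₁

/-- IMPORT 8 (PROVED): `2 × 2` Cayley–Hamilton for an eigenvector of eigenvalue `1` and `det = 1`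
(apply it to `-M` to get `(M + 1)² = 0` from an eigenvector of eigenvalue `-1`). -/
example {R : Type*} [CommRing R] (M : Matrix (Fin 2) (Fin 2) R) (c : Fin 2 → R)
    (hc : IsUnit (c 0) ∨ IsUnit (c 1)) (hMc : M *ᵥ c = c) (hdet : M.det = 1) :
    (M - 1) * (M - 1) = 0 :=
  mul_self_sub_one_eq_zero_of_mulVec_eq_of_det_eq_one M c hc hMc hdet

/-- IMPORT 9 (PROVED, Mathlib + tree): `ℚ_v ≃ ℚ_p` and Teichmüller `μ_{p-1} ⊂ ℤ_p` — carriers of the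
optional Plan-A helper `helper_exists_isPrimitiveRoot_adicCompletion`. -/
example (v : HeightOneSpectrum (𝓞 ℚ)) [Fact (Nat.Prime (Rat.HeightOneSpectrum.primesEquiv v : ℕ))] :
    v.adicCompletion ℚ ≃A[ℚ] ℚ_[Rat.HeightOneSpectrum.primesEquiv v] :=
  Rat.HeightOneSpectrum.adicCompletion.padicEquiv v

example (p : ℕ) [Fact p.Prime] : ∃ ζ : ℤ_[p], IsPrimitiveRoot ζ (p - 1) :=
  Literature.NumberTheory.EllipticCurves.Kato2004.padicInt_exists_isPrimitiveRoot_sub_one p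

/-! ## §1  The eigenline re-cut of the Tate block (helpers E1–E7)

Notation: `K_v = v.adicCompletion K`, `K̄_v = AlgebraicClosure K_v`, `Ψ : K̄_vˣ → E(K̄_v)` a TWISTED Tate
parametrisation with kernel `q^ℤ` and sign `ε : Γ_{K_v} → {±1}` (`σ • Ψ(u) = ε σ • Ψ(σ u)`), as delivered by
`TateCurve.exists_twistedTateUniformisation_tateJ` with `ε σ = if σ t = t then 1 else -1`. -/

section Local

variable {K : Type} [Field K] [NumberField K] (W : WeierstrassCurve K) (v : HeightOneSpectrum (𝓞 K))

/-- **E1 (PROVED here; pure import) — the Tate EIGENPOINT.** For a root of unity `u ∈ K̄_vˣ` of prime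
order `p`, `L := Ψ(u)` is a non-zero `p`-torsion point, and every `σ ∈ Γ_{K_v}` FIXING `u` acts on `L`
by the sign `ε σ`.  (`map_ofMul_ne_zero_of_pow_eq_one`, `zsmul_map_ofMul_eq_zero_of_pow_eq_one`, `htw`.)
Replaces the "shape on ALL `p₁p₂`-torsion" of k2-g8 T1: only the eigenpoint is needed downstream. -/
theorem helper_tate_eigenpoint_local {q : v.adicCompletion K} (hq0 : q ≠ 0) (hq1 : Valued.v q < 1)
    (Ψ : Additive (AlgebraicClosure (v.adicCompletion K))ˣ →+ localPoints W (v.adicCompletion K))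
    (hker : ∀ u : (AlgebraicClosure (v.adicCompletion K))ˣ, Ψ (Additive.ofMul u) = 0 ↔
      ∃ n : ℤ, (u : AlgebraicClosure (v.adicCompletion K)) =
        algebraMap (v.adicCompletion K) (AlgebraicClosure (v.adicCompletion K)) q ^ n)
    (ε : absoluteGaloisGroup (v.adicCompletion K) → ℤ)
    (htw : ∀ (σ : absoluteGaloisGroup (v.adicCompletion K))
        (u : (AlgebraicClosure (v.adicCompletion K))ˣ),
      σ • Ψ (Additive.ofMul u) = ε σ • Ψ (Additive.ofMul (Units.map
        (Field.absoluteGaloisGroup.toAlgEquiv (v.adicCompletion K) σ :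
          AlgebraicClosure (v.adicCompletion K) →* AlgebraicClosure (v.adicCompletion K)) u)))
    {p : ℕ} [Fact p.Prime] {u : (AlgebraicClosure (v.adicCompletion K))ˣ} (hup : u ^ p = 1)
    (hu1 : u ≠ 1) :
    Ψ (Additive.ofMul u) ≠ 0 ∧ (p : ℤ) • Ψ (Additive.ofMul u) = 0 ∧
      ∀ σ : absoluteGaloisGroup (v.adicCompletion K),
        Field.absoluteGaloisGroup.toAlgEquiv (v.adicCompletion K) σ u = u →
          σ • Ψ (Additive.ofMul u) = ε σ • Ψ (Additive.ofMul u) := by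
  refine ⟨map_ofMul_ne_zero_of_pow_eq_one (W := W) (v := v) hq0 hq1 Ψ hker hup hu1,
    zsmul_map_ofMul_eq_zero_of_pow_eq_one (W := W) (v := v) Ψ hup, fun σ hσ ↦ ?_⟩
  have hfix : Units.map (Field.absoluteGaloisGroup.toAlgEquiv (v.adicCompletion K) σ :
      AlgebraicClosure (v.adicCompletion K) →* AlgebraicClosure (v.adicCompletion K)) u = u :=
    Units.ext (by simpa using hσ)
  simpa only [hfix] using htw σ u

/-- **E1′ (PROVED here) — roots of unity of `K̄` give the units `u` of E1**, fixed by every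
`σ ∈ Γ_{K_v}` whose restriction fixes them in `K̄` (IMPORT 6). -/
theorem helper_unit_of_closureEmb {p : ℕ} (hp : p.Prime) {ζ : AlgebraicClosure K} (hζp : ζ ^ p = 1)
    (hζ1 : ζ ≠ 1) :
    ∃ u : (AlgebraicClosure (v.adicCompletion K))ˣ,
      (u : AlgebraicClosure (v.adicCompletion K)) = closureEmb (K := K) (v.adicCompletion K) ζ ∧
      u ^ p = 1 ∧ u ≠ 1 ∧
      ∀ σ : absoluteGaloisGroup (v.adicCompletion K), resGal (K := K) (v.adicCompletion K) σ • ζ = ζ →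
        Field.absoluteGaloisGroup.toAlgEquiv (v.adicCompletion K) σ u = u := by
  have hζu : IsUnit (closureEmb (K := K) (v.adicCompletion K) ζ) :=
    (IsUnit.of_pow_eq_one hζp hp.ne_zero).map _
  refine ⟨hζu.unit, rfl, Units.ext ?_, fun h ↦ hζ1 ?_, fun σ hσ ↦ ?_⟩
  · rw [Units.val_pow_eq_pow_val, IsUnit.unit_spec, ← map_pow, hζp, map_one, Units.val_one]
  · have h' := congrArg Units.val h
    rw [IsUnit.unit_spec, Units.val_one, ← map_one (closureEmb (K := K) (v.adicCompletion K))] at h'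
    exact (closureEmb (K := K) (v.adicCompletion K)).injective h'
  · rw [IsUnit.unit_spec, ← Field.absoluteGaloisGroup.smul_def, ← closureEmb_resGal_smul, hσ]

end Local

section Global

variable {K : Type} [Field K] [NumberField K] (W : WeierstrassCurve K) [W.IsElliptic]
  {v : HeightOneSpectrum (𝓞 K)}

/-- **E2 (PROVED here from E1, E1′ and IMPORTS 1, 5) — the GLOBAL Tate eigenline with a COMMON sign.**  At a multiplicative place `v`
there is ONE sign function `ε : Γ_{K_v} → {±1}` (the unramified quadratic twist of Silverman V.5.3,
trivial iff split) such that for EVERY prime `p` and every non-trivial `p`-th root of unity `ζ ∈ K̄`,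
some non-zero `P ∈ E[p](K̄)` satisfies `σ|_{K̄} • P = ε σ • P` for all `σ ∈ Γ_{K_v}` with `σ|_{K̄} ζ = ζ`.
Proof plan (pattern of PROVED `exists_unipotent_of_hasMultiplicativeReductionAt`): IMPORT 1 → `ε`;
E1′ → `u`; E1 → `L = Ψ(u)`; IMPORT 5 → global `P` with `pointsMap P = L`; `pointsMap_smul` +
`pointsMapOfEmb_injective` transport the eigen-relation.  No `hζ`, no `p ∤ v`, uniform in `char k_v`. -/
theorem helper_tate_eigenline_global (hmult : W.HasMultiplicativeReductionAt v) :
    ∃ ε : absoluteGaloisGroup (v.adicCompletion K) → ℤ,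
      (∀ σ, ε σ = 1 ∨ ε σ = -1) ∧
      ∀ (p : ℕ), p.Prime → ∀ ζ : AlgebraicClosure K, ζ ^ p = 1 → ζ ≠ 1 →
        ∃ P : geomPoints W, P ≠ 0 ∧ p • P = 0 ∧
          ∀ σ : absoluteGaloisGroup (v.adicCompletion K),
            resGal (K := K) (v.adicCompletion K) σ • ζ = ζ →
              resGal (K := K) (v.adicCompletion K) σ • P = ε σ • P := by
  obtain ⟨q, t, Ψ, hq0, hq1, -, -, -, -, -, hker, htw⟩ :=
    TateCurve.exists_twistedTateUniformisation_tateJ W v hmult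
  refine ⟨fun σ ↦ if Field.absoluteGaloisGroup.toAlgEquiv (v.adicCompletion K) σ t = t then (1 : ℤ)
      else -1, fun σ ↦ ?_, fun p hp ζ hζp hζ1 ↦ ?_⟩
  · by_cases h : Field.absoluteGaloisGroup.toAlgEquiv (v.adicCompletion K) σ t = t
    · exact Or.inl (if_pos h)
    · exact Or.inr (if_neg h)
  haveI : Fact p.Prime := ⟨hp⟩
  -- E1′: the unit `u = ι(ζ) ∈ K̄_vˣ`; E1: the eigenpoint `L = Ψ(u)`
  obtain ⟨u, hu, hup, hu1, hufix⟩ := helper_unit_of_closureEmb (K := K) v hp hζp hζ1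
  obtain ⟨hL0, hpL, hLσ⟩ := helper_tate_eigenpoint_local W v hq0 hq1 Ψ hker
    (fun σ ↦ if Field.absoluteGaloisGroup.toAlgEquiv (v.adicCompletion K) σ t = t then (1 : ℤ)
      else -1) htw hup hu1
  -- IMPORT 5: the eigenpoint comes from `E(K̄)`
  have hpL' : p • Ψ (Additive.ofMul u) = 0 := by rw [← natCast_zsmul]; exact hpL
  obtain ⟨P, hpP, hPL⟩ := exists_pointsMapOfEmb_eq_of_nsmul_eq_zero W
    (closureEmb (K := K) (v.adicCompletion K)) hp.ne_zero hpL'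
  have hinj : Function.Injective (pointsMap W (v.adicCompletion K)) := pointsMapOfEmb_injective W _
  refine ⟨P, ?_, hpP, fun σ hσ ↦ hinj ?_⟩
  · rintro rfl
    exact hL0 (by rw [← hPL, map_zero])
  · have key := hLσ σ (hufix σ hσ)
    rw [← hPL] at key
    rw [pointsMap_smul, map_zsmul]
    exact key

/-- **E3 (PROVED here, pure algebra) — the sign is read off at an ODD level.** If `ε ∈ {±1}`,
`P ≠ 0` is `p`-torsion with `p` odd and `ε • P = -P`, then `ε = -1`. (Used with `p = 5`.) -/
theorem helper_sign_eq_neg_one {A : Type*} [AddCommGroup A] {P : A} (hP : P ≠ 0) {p : ℕ}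
    (hp : Odd p) (hpP : p • P = 0) {ε : ℤ} (hε : ε = 1 ∨ ε = -1) (h : ε • P = -P) : ε = -1 := by
  rcases hε with rfl | rfl
  · exfalso
    rw [one_zsmul] at h
    have h2 : 2 • P = 0 := by rw [two_nsmul]; nth_rw 1 [h]; exact neg_add_cancel P
    have hd : addOrderOf P ∣ 1 := by
      have := Nat.dvd_gcd (addOrderOf_dvd_of_nsmul_eq_zero h2) (addOrderOf_dvd_of_nsmul_eq_zero hpP)
      rwa [Nat.Coprime.gcd_eq_one (Nat.coprime_two_left.mpr hp)] at this
    exact hP (AddMonoid.addOrderOf_eq_one_iff.mp (Nat.dvd_one.mp hd))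
  · rfl

/-- **E4 (PROVED here; pure import) — conjugating a decomposition-group element onto `Γ_{K_v}`.**  If `φ ∈ D_𝔓` for a
prime `𝔓` above `v`, then `φ = g · σ|_{K̄} · g⁻¹` for some `g ∈ Γ_K`, `σ ∈ Γ_{K_v}`
(IMPORT 4: `g • 𝔓₀ = 𝔓`; IMPORT 2: `D_{𝔓₀} = range resGal`; `MulAction.stabilizer_smul_eq_stabilizer_map_conj`). -/
theorem helper_conj_resGal_of_mem_decompositionSubgroup {𝔓 : Ideal (absIntegers (𝓞 K) K)}
    (h𝔓 : 𝔓 ∈ v.primesAbove) {φ : absoluteGaloisGroup K}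
    (hφ : φ ∈ 𝔓.decompositionSubgroup (absoluteGaloisGroup K)) :
    ∃ (g : absoluteGaloisGroup K) (σ : absoluteGaloisGroup (v.adicCompletion K)),
      φ = g * resGal (K := K) (v.adicCompletion K) σ * g⁻¹ := by
  obtain ⟨g, hg⟩ := HeightOneSpectrum.exists_smul_eq_of_mem_primesAbove_holds
    (adicCompletionPrime_mem_primesAbove K v) h𝔓
  subst hg
  rw [Ideal.decompositionSubgroup_smul, Subgroup.mem_pointwise_smul_iff_inv_smul_mem,
    decompositionSubgroup_adicCompletionPrime_eq_range] at hφ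
  obtain ⟨σ, hσ⟩ := MonoidHom.mem_range.mp hφ
  refine ⟨g, σ, ?_⟩
  rw [resGal_eq_absGaloisRestrict]
  change φ = g * (absGaloisRestrict K (v.adicCompletion K)).toMonoidHom σ * g⁻¹
  rw [hσ, MulAut.smul_def, MulAut.conj_inv_apply]
  group

/-- **E5 (PROVED here) — `χ̄_N(σ) = 1` means `σ` fixes the `N`-th roots of unity of `K̄`**
(`modNCyclotomicCharacter_spec`).  Turns k2-g8's hypotheses `h3`/`h5` into the fixing hypotheses of E2,
conjugation-invariantly (`χ̄_N` is a homomorphism to an abelian group). -/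
theorem helper_smul_eq_self_of_modNCyclotomicCharacter_eq_one {N : ℕ} [NeZero N]
    {σ : absoluteGaloisGroup K} (hσ : modNCyclotomicCharacter K N σ = 1) {ζ : AlgebraicClosure K}
    (hζ : ζ ^ N = 1) : σ • ζ = ζ := by
  have h := modNCyclotomicCharacter_spec K N σ ζ hζ
  rw [hσ, Units.val_one] at h
  rcases Nat.lt_or_ge 1 N with hN | hN
  · haveI : Fact (1 < N) := ⟨hN⟩
    rwa [ZMod.val_one, pow_one] at h
  · have hN1 : N = 1 := le_antisymm hN (Nat.pos_of_ne_zero (NeZero.ne N))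
    subst hN1
    rw [pow_one] at hζ
    rw [hζ, smul_one]

omit [NumberField K] [W.IsElliptic] in
/-- **E5′ (PROVED here) — `φ = -1` on `E[n]` is conjugation-invariant.** -/
theorem helper_neg_conj {n : ℤ} {φ g : absoluteGaloisGroup K}
    (hneg : ∀ P : W.geomTorsion n, φ • P = -P) (P : W.geomTorsion n) :
    (g⁻¹ * φ * g) • P = -P := by
  rw [mul_smul, mul_smul, hneg, smul_neg, inv_smul_smul]

end Global

/-! ## §2  The road-facing outputs (currency of k2-g8 Piece C `SurjThreeOfCuspData`) -/

/-- **E6 = N1e (PROVED here from E2–E5; only E2 is open) — a `-1`-EIGENVECTOR of `Frob_q` on `E[3]`.**  `E/ℚ` multiplicative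
at `v`, `φ` a Frobenius at `𝔓 ∣ v` with `χ̄₃(φ) = χ̄₅(φ) = 1` acting as `-1` on `E[5]` ⇒ some
`P ∈ E[3] ∖ 0` has `φ • P = -P`.  Assembly: IMPORT 3 + E4 (`φ = g σ|_{K̄} g⁻¹`), E5 (`σ|_{K̄}` fixes
`ζ₃, ζ₅`), E2 at `p = 5` with E5′ + E3 (`ε σ = -1`), E2 at `p = 3` (`σ|_{K̄} • P₃ = -P₃`), `P := g • P₃`.
SAME hypotheses as k2-g8 T2; no `q`, valid also for `v ∣ 15`. -/
theorem helper_frob_neg_eigenvector_three (E : WeierstrassCurve ℚ) [E.IsElliptic]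
    {v : HeightOneSpectrum (𝓞 ℚ)} (hmult : E.HasMultiplicativeReductionAt v)
    {𝔓 : Ideal (absIntegers (𝓞 ℚ) ℚ)} (h𝔓 : 𝔓 ∈ v.primesAbove) {φ : absoluteGaloisGroup ℚ}
    (hφ : IsArithFrobAt (𝓞 ℚ) φ 𝔓) (h3 : modNCyclotomicCharacter ℚ 3 φ = 1)
    (h5 : modNCyclotomicCharacter ℚ 5 φ = 1) (hneg : ∀ P : E.geomTorsion 5, φ • P = -P) :
    ∃ P : E.geomTorsion 3, P ≠ 0 ∧ φ • P = -P := by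
  haveI := h𝔓.1
  -- E4: `φ = g σ|_{K̄} g⁻¹`
  obtain ⟨g, σ, hφg⟩ :=
    helper_conj_resGal_of_mem_decompositionSubgroup (K := ℚ) h𝔓 hφ.mem_stabilizer
  have hφ' : resGal (K := ℚ) (v.adicCompletion ℚ) σ = g⁻¹ * φ * g := by
    rw [hφg]; group
  -- E2: the global eigenline with its common sign `ε`
  obtain ⟨ε, hε, hline⟩ := helper_tate_eigenline_global E hmult
  -- E5: `σ|_{K̄}` fixes `ζ₃`, `ζ₅` (cyclotomic characters are conjugation-invariant)
  have hfix : ∀ (N : ℕ) [NeZero N], modNCyclotomicCharacter ℚ N φ = 1 →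
      ∀ ζ : AlgebraicClosure ℚ, ζ ^ N = 1 → resGal (K := ℚ) (v.adicCompletion ℚ) σ • ζ = ζ := by
    intro N _ hN ζ hζ
    refine helper_smul_eq_self_of_modNCyclotomicCharacter_eq_one ?_ hζ
    rw [hφ', map_mul, map_mul, hN, mul_one, map_inv, inv_mul_cancel]
  -- E5′: `g⁻¹ φ g = -1` on `E[5]`, read in `E(K̄)`
  have hconj : ∀ (P : geomPoints E) (hP : P ∈ E.geomTorsion 5), (g⁻¹ * φ * g) • P = -P :=
    fun P hP ↦ congrArg Subtype.val (helper_neg_conj E (g := g) hneg ⟨P, hP⟩)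
  have hmem : ∀ (n : ℕ) (P : geomPoints E), n • P = 0 → P ∈ E.geomTorsion n := by
    intro n P h
    refine (Submodule.mem_torsionBy_iff _ _).mpr ?_
    change ((n : ℕ) : ℤ) • P = 0
    rw [natCast_zsmul, h]
  -- level 5: the sign `ε σ = -1` (E3)
  obtain ⟨ζ₅, hζ₅⟩ := HasEnoughRootsOfUnity.prim (M := AlgebraicClosure ℚ) (n := 5)
  obtain ⟨P₅, hP₅0, h5P₅, hP₅⟩ :=
    hline 5 (by norm_num) ζ₅ hζ₅.pow_eq_one (hζ₅.ne_one (by norm_num))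
  have hεσ : ε σ = -1 := by
    have h1 := hP₅ σ (hfix 5 h5 ζ₅ hζ₅.pow_eq_one)
    have h2 : resGal (K := ℚ) (v.adicCompletion ℚ) σ • P₅ = -P₅ := by
      rw [hφ']; exact hconj P₅ (hmem 5 P₅ h5P₅)
    exact helper_sign_eq_neg_one hP₅0 ⟨2, by norm_num⟩ h5P₅ (hε σ) (h1.symm.trans h2)
  -- level 3: the `-1`-eigenvector, conjugated back by `g`
  obtain ⟨ζ₃, hζ₃⟩ := HasEnoughRootsOfUnity.prim (M := AlgebraicClosure ℚ) (n := 3)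
  obtain ⟨P₃, hP₃0, h3P₃, hP₃⟩ :=
    hline 3 (by norm_num) ζ₃ hζ₃.pow_eq_one (hζ₃.ne_one (by norm_num))
  have h3' : (g⁻¹ * φ * g) • P₃ = -P₃ := by
    rw [← hφ', hP₃ σ (hfix 3 h3 ζ₃ hζ₃.pow_eq_one), hεσ, neg_one_zsmul]
  refine ⟨⟨g • P₃, smul_mem_torsionBy g (hmem 3 P₃ h3P₃)⟩, fun h0 ↦ hP₃0 ?_, Subtype.ext ?_⟩
  · have h0' : g • P₃ = 0 := by simpa using congrArg Subtype.val h0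
    exact (smul_eq_zero_iff_eq g).mp h0'
  · show φ • g • P₃ = -(g • P₃)
    have h4 := congrArg (g • ·) h3'
    simp only [smul_smul, smul_neg] at h4
    rwa [show g * (g⁻¹ * φ * g) = φ * g by group, mul_smul] at h4

/-- **E7 = T2′ (PROVED here; IMPORTS 7–8) — Cayley–Hamilton closes k2-g8 T2 VERBATIM.**  A `-1`-eigenvector on `E[3]` plus
`det ρ̄₃(φ) = χ̄₃(φ) = 1` give `(φ + 1)² = 0` on `E[3]`: in the frame `exists_frame_galoisRepTorsion_rat`
(IMPORT 7 / `det Φ = χ̄`), apply IMPORT 8 to `-M` (`det (-M) = det M` for `2 × 2`).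
Honours `Disproof.switch_false_without_det` (the determinant is used). -/
theorem helper_addOneSq_of_neg_eigenvector (E : WeierstrassCurve ℚ) [E.IsElliptic]
    {φ : absoluteGaloisGroup ℚ} (h3 : modNCyclotomicCharacter ℚ 3 φ = 1)
    {P : E.geomTorsion 3} (hP : P ≠ 0) (hφP : φ • P = -P) :
    ∀ Q : E.geomTorsion 3, φ • (φ • Q + Q) + (φ • Q + Q) = 0 := by
  haveI : Fact (Nat.Prime 3) := ⟨by norm_num⟩
  obtain ⟨e, Φ, he, -, hdet, -⟩ := exists_frame_galoisRepTorsion_rat E 3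
  set M : Matrix (Fin 2) (Fin 2) (ZMod 3) :=
    ((Φ (galoisRepTorsion E ((3 : ℕ) : ℤ) φ) : GL (Fin 2) (ZMod 3)) : Matrix (Fin 2) (Fin 2) (ZMod 3))
    with hM
  -- the frame: `e (φ • Q) = M e(Q)`
  have hMv : ∀ Q : E.geomTorsion 3, e (φ • Q) = M *ᵥ e Q := fun Q ↦ by
    rw [← galoisRepTorsion_apply]; exact he _ Q
  -- `det M = χ̄₃(φ) = 1` (this is where the determinant is used: `Disproof.switch_false_without_det`)
  have hdetM : M.det = 1 := by
    have h := hdet φ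
    rw [modPCyclotomicCharacterZMod_eq_modNCyclotomicCharacter, h3] at h
    rw [hM, ← Matrix.GeneralLinearGroup.val_det_apply, h, Units.val_one]
  -- the `-1`-eigenvector in coordinates
  have hc : M *ᵥ e P = -(e P) := by rw [← hMv, hφP, map_neg]
  have hc0 : e P ≠ 0 := fun h ↦ hP (by simpa using congrArg e.symm h)
  have hunit : IsUnit (e P 0) ∨ IsUnit (e P 1) := by
    by_contra hcon
    simp only [not_or, isUnit_iff_ne_zero, ne_eq, not_not] at hcon
    apply hc0
    funext i
    fin_cases i
    · simpa using hcon.1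
    · simpa using hcon.2
  -- Cayley–Hamilton for `-M` (IMPORT 8): `(-M - 1)² = 0`, i.e. `(M + 1)² = 0`
  have hneg : (-M) *ᵥ e P = e P := by rw [Matrix.neg_mulVec, hc, neg_neg]
  have hdet' : (-M).det = 1 := by
    rw [Matrix.det_fin_two] at hdetM ⊢
    simp only [Matrix.neg_apply]
    linear_combination hdetM
  have hsq := mul_self_sub_one_eq_zero_of_mulVec_eq_of_det_eq_one (-M) (e P) hunit hneg hdet'
  have hsq' : (M + 1) * (M + 1) = 0 := by
    rw [show -M - 1 = -(M + 1) by abel, neg_mul_neg] at hsq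
    exact hsq
  intro Q
  apply e.injective
  simp only [map_add, map_zero, hMv]
  have h : ((M + 1) * (M + 1)) *ᵥ e Q = 0 := by rw [hsq', Matrix.zero_mulVec]
  rwa [← Matrix.mulVec_mulVec, Matrix.add_mulVec, Matrix.one_mulVec, Matrix.add_mulVec,
    Matrix.one_mulVec] at h

/-- **k2-g8 T2, DISCHARGED (sorry-free composition of E6 + E7)**: exactly the signature of
`StubSwitchK2G8.helper_frob_addOneSq_three`, so k2-g8's PROVED `surjThreeOfCuspData_of_helpers` is untouched and
its T1 (`helper_twistedTate_addOneSq_local`) is no longer needed. -/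
theorem helper_frob_addOneSq_three' (E : WeierstrassCurve ℚ) [E.IsElliptic]
    {v : HeightOneSpectrum (𝓞 ℚ)} (hmult : E.HasMultiplicativeReductionAt v)
    {𝔓 : Ideal (absIntegers (𝓞 ℚ) ℚ)} (h𝔓 : 𝔓 ∈ v.primesAbove) {φ : absoluteGaloisGroup ℚ}
    (hφ : IsArithFrobAt (𝓞 ℚ) φ 𝔓) (h3 : modNCyclotomicCharacter ℚ 3 φ = 1)
    (h5 : modNCyclotomicCharacter ℚ 5 φ = 1) (hneg : ∀ P : E.geomTorsion 5, φ • P = -P) :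
    ∀ Q : E.geomTorsion 3, φ • (φ • Q + Q) + (φ • Q + Q) = 0 := by
  obtain ⟨P, hP, hφP⟩ := helper_frob_neg_eigenvector_three E hmult h𝔓 hφ h3 h5 hneg
  exact helper_addOneSq_of_neg_eigenvector E h3 hP hφP

/-- **E8 = FIN2′ (OPEN, S; optional ALTERNATIVE to k2-g8 FIN2 + Rneg, not on the road)** — the stable-line character takes the
value `-1` at `φ` directly: if `P` spans a `Γ_ℚ`-stable line of `E[3]` with character `r`, `χ̄₃(φ) = 1`, and
`φ` has a `-1`-eigenvector `P₃ ∈ E[3]`, then `r φ = -1` (if `P₃ ∈ 𝔽₃ P` read it off; else `{P, P₃}` is a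
basis, `φ` is `diag(r φ, -1)` plus upper entry, and `det = χ̄₃(φ) = 1` by IMPORT 7 ⇒ `r φ = -1`). -/
theorem helper_lineChar_eq_neg_one_of_neg_eigenvector (E : WeierstrassCurve ℚ) [E.IsElliptic]
    {P : E.geomTorsion 3} (hP0 : P ≠ 0) {r : absoluteGaloisGroup ℚ →* (ZMod 3)ˣ}
    (hr : ∀ σ : absoluteGaloisGroup ℚ, σ • P = ((r σ : (ZMod 3)ˣ) : ZMod 3).val • P)
    {φ : absoluteGaloisGroup ℚ} (h3 : modNCyclotomicCharacter ℚ 3 φ = 1)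
    {P₃ : E.geomTorsion 3} (hP₃ : P₃ ≠ 0) (hφ : φ • P₃ = -P₃) : r φ = -1 := by
  sorry

/-! ## §3  Plan A (aside) — `μ₁₅ ⊂ ℚ_q`: discharging k2-g8 T1's `hζ` by Teichmüller, if a prover keeps T1/T2 -/

/-- **A1 (OPEN, S; optional aside) — `K_v = ℚ_q` contains the `n`-th roots of unity for `n ∣ q - 1`** (IMPORT 9:
`padicEquiv` + `Kato2004.padicInt_exists_isPrimitiveRoot_sub_one`, `IsPrimitiveRoot.pow`,
`IsPrimitiveRoot.map_of_injective`). -/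
theorem helper_exists_isPrimitiveRoot_adicCompletion {q n : ℕ} (hq : q.Prime) (hn : n ≠ 0)
    (hnq : n ∣ q - 1) {v : HeightOneSpectrum (𝓞 ℚ)} (hv : (q : 𝓞 ℚ) ∈ v.asIdeal) :
    ∃ ζ : v.adicCompletion ℚ, IsPrimitiveRoot ζ n := by
  sorry

/-- **A2 (PROVED here) — roots of unity lying in the base are fixed by `Γ`**: with a primitive `n`-th root
`ζ ∈ F`, every `F`-automorphism of `F̄` fixes every `z ∈ F̄` with `z ^ n = 1`.  With A1 (`n = 15`) this is
k2-g8 T1's hypothesis `hζ` (for ALL `σ`, not only those moving `t`). -/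
theorem helper_algEquiv_apply_eq_self_of_pow_eq_one {F : Type*} [Field F] {n : ℕ} {ζ : F}
    (hζ : IsPrimitiveRoot ζ n) (hn : n ≠ 0) (σ : AlgebraicClosure F ≃ₐ[F] AlgebraicClosure F)
    {z : AlgebraicClosure F} (hz : z ^ n = 1) : σ z = z := by
  haveI : NeZero n := ⟨hn⟩
  have hζ' : IsPrimitiveRoot (algebraMap F (AlgebraicClosure F) ζ) n :=
    hζ.map_of_injective (algebraMap F (AlgebraicClosure F)).injective
  obtain ⟨i, -, rfl⟩ := hζ'.eq_pow_of_pow_eq_one hz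
  rw [map_pow, AlgEquiv.commutes]

end Summit.ABC.ABC.Cruxes.FreyModularity.StubSwitchK1G9

end
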